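import Literature.Probability.RandomPlanarGeometry.BoundaryCorrespondence
import Literature.Probability.RandomPlanarGeometry.HalfPlaneFill
import Literature.Probability.RandomPlanarGeometry.ChordalCapacityDivergence

/-!
# Crux `HexConjecture` (stmt-CriticalPhenomena-0808), line `root-locality-replaces-loewner`,
stub `stub_rangeIdentification`: the FILL LEMMA for compact connected sets from `a` to `b`
(part 2a)

Landing target:
`Summits/CriticalPhenomena/SAWScalingLimit/Theorems/SAWDevelopingMapHexConjectureRangeIdentificationFill.lean`
(`--supports stmt-CriticalPhenomena-0808`).

The subsequential limits `ν` of the range laws of the critical hexagonal SAW (part 1b) are laws of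
random COMPACT SETS `K ⊆ cl D` which are connected, contain both marked points `a, b` of the
Dobrushin domain `(D; a, b)` and (part 2c) meet `∂D` only at `a, b` — but are not known to be
simple curves.  [LSW]'s identification of a law by its hull-avoidance probabilities (Lemma 3.2)
rests, for simple paths `γ` from `0` to `∞` in `ℍ`, on "`γ` avoids a test set `S` attached to `ℝ`
iff it avoids its fill `Fill_ℍ(S)`" (`disjoint_range_hpFill_iff`).  This file proves the same
for the sets `K` above, read through the boundary extension `ψ` of a chordal uniformizing map
`φ : (ℍ; 0, ∞) → (D; a, b)`:

* `fill_lemma` (registered as `rangeIdentification_fill`): if `K ∩ ψ(T) = ∅` for a closed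
  bounded `T ⊆ cl ℍ` with `0 ∉ T`, then `0 ∉ hpFill T` and `K ∩ ψ(hpFill T) = ∅`.

Proof (plane topology + Carathéodory).  FRONTIER ARGUMENT (`frontier_point`): if `O ⊆ ℍ` is a
bounded open set whose frontier points in `ℍ` lie in `T`, a point `p ∈ K` of
`cl φ(O) ∖ φ(O)` is `ψ(q)` with `q ∈ ∂O` (continuity of `ψ` on the compact `cl O`), and `q ∉ T`
forces `q` real, `p ∈ ∂D ∩ K ⊆ {a, b}`, `p ≠ b = ψ(∞)`, so `p = a` and `q = 0 ∈ cl O`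
(injectivity of the boundary correspondence).  (i) `0 ∉ hpFill T`
(`zero_notMem_hpFill_of_disjoint`): otherwise a bounded component `O` of `ℍ ∖ T` contains the
half-disc `ℍ ∩ B(0, r)` (`T ∌ 0` is closed), hence `φ⁻¹` of all points of `D` near `a`
(`φ⁻¹ → 0` at `a`); the open set `G = φ(O) ∪ B(a, s)` meets the connected `K ∋ a` but misses
`b ∈ K`, so `K` has a point on `∂G`, which the frontier argument and the choice of `s` exclude.
(ii) every `z ∈ ℍ` with `φ z ∈ K` lies in the unbounded component of `ℍ ∖ T`
(`mem_unboundedComponent_of_apply_mem`): otherwise its component `O` is bounded, `G = φ(O)`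
meets `K` and misses `b`, and the frontier argument puts `0 ∈ cl O ⊆ hpFill T`, contradicting
(i).  (iii) hence `K ∩ ψ(hpFill T) = ∅` (`disjoint_image_hpFill`).

Also: the pulled-back set `{z ∈ cl ℍ | ψ z ∈ K}` is closed, meets `ℝ` only at `0`, and a Cantor
intersection lemma (`exists_disjoint_of_disjoint_iInter`) for the outer continuity of avoidance.

References: G. F. Lawler, O. Schramm, W. Werner, *Conformal restriction: the chordal case*,
J. Amer. Math. Soc. **16** (2003), §2 p. 8 (Fillings), Lemma 3.2; Ch. Pommerenke, *Boundary
Behaviour of Conformal Maps* (1992), Thm. 2.6 (Carathéodory).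
-/

noncomputable section

namespace Summit.CriticalPhenomena.SAWScalingLimit.Theorems.HexConjecture.RootLocality.Range

open scoped Topology
open Filter Set Metric Complex Bornology
open UpperHalfPlane (upperHalfPlaneSet isOpen_upperHalfPlaneSet)
open Literature.Probability.RandomPlanarGeometry

/-! ### Boundary correspondence facts for a chordal uniformizing map -/

section Boundary

variable {D : DobrushinDomain} {φ : ConformalEquiv upperHalfPlaneSet D.carrier}

/-- Real points are sent to `∂D` by the boundary extension (Carathéodory: the disc extension maps
the circle into `∂D`). [cite: PommerenkeBBCM1992, Thm. 2.6] -/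
theorem boundaryExtension_mem_frontier_of_im_eq_zero
    (hC : JordanDomain.exists_continuousOn_extension) {z : ℂ} (hz : z.im = 0) :
    φ.boundaryExtension z ∈ frontier D.carrier := by
  obtain ⟨Ψ, hΨc, hΨeq, -, -⟩ := hC D.toJordanDomain (cayley.symm.trans φ)
  have hzre : z = ((z.re : ℝ) : ℂ) := Complex.ext (by simp) (by simp [hz])
  rw [JordanDomain.boundaryExtension_eq_of_extension φ hΨc hΨeq (le_of_eq hz.symm)]
  refine JordanDomain.mapsTo_frontier_of_extension hΨc hΨeq ?_
  rw [hzre]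
  exact mem_sphere_zero_iff_norm.2 (norm_cayleyFun_ofReal z.re)

/-- Only `0` is sent to `a` (injectivity of the boundary correspondence).
[cite: PommerenkeBBCM1992, Thm. 2.6] -/
theorem eq_zero_of_boundaryExtension_eq_pt_zero (hC : JordanDomain.exists_continuousOn_extension)
    (hφ : D.IsChordalUniformizing φ) {z : ℂ} (hz : 0 ≤ z.im)
    (h : φ.boundaryExtension z = D.pt 0) : z = 0 := by
  by_contra hz0
  exact MarkedDomain.boundaryExtension_ne_pt_zero hC hφ hz hz0 h

/-- A point of the closed half-plane sent into a set meeting `∂D` only at the marked points is in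
`ℍ` or is `0`: real points other than `0` are excluded. [folklore] -/
theorem eq_zero_of_im_eq_zero_of_mem (hC : JordanDomain.exists_continuousOn_extension)
    (hφ : D.IsChordalUniformizing φ) {K : Set ℂ}
    (hKfr : K ∩ frontier D.carrier ⊆ {D.pt 0, D.pt 1}) {z : ℂ} (hz : z.im = 0)
    (hzK : φ.boundaryExtension z ∈ K) : z = 0 := by
  rcases hKfr ⟨hzK, boundaryExtension_mem_frontier_of_im_eq_zero hC hz⟩ with ha | hb
  · exact eq_zero_of_boundaryExtension_eq_pt_zero hC hφ (le_of_eq hz.symm) ha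
  · exact absurd hb (MarkedDomain.boundaryExtension_ne_pt_one hC hφ (le_of_eq hz.symm))

/-- The image of a subset of `ℍ` under `φ` is `D ∩ φ⁻¹⁻¹`. [folklore] -/
theorem image_eq_inter_preimage_symm {O : Set ℂ} (hO : O ⊆ upperHalfPlaneSet) :
    φ '' O = D.carrier ∩ φ.symm ⁻¹' O := by
  ext w
  constructor
  · rintro ⟨x, hx, rfl⟩
    exact ⟨φ.mapsTo (hO hx), by rw [mem_preimage, φ.symm_apply_apply (hO hx)]; exact hx⟩
  · rintro ⟨hwD, hw⟩
    exact ⟨φ.symm w, hw, φ.apply_symm_apply hwD⟩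

/-- `φ` maps open subsets of `ℍ` to open sets. [folklore] -/
theorem isOpen_image {O : Set ℂ} (hO : IsOpen O) (hOH : O ⊆ upperHalfPlaneSet) : IsOpen (φ '' O) := by
  rw [image_eq_inter_preimage_symm hOH]
  exact φ.symm.continuousOn.isOpen_inter_preimage D.isOpen hO

/-- **Closures of images of bounded sets**: `cl φ(O) ⊆ ψ(cl O)` for `O ⊆ ℍ` bounded
(continuity of the boundary extension on the compact set `cl O ⊆ cl ℍ`).
[cite: PommerenkeBBCM1992, Thm. 2.6] -/
theorem closure_image_subset (hC : JordanDomain.exists_continuousOn_extension) {O : Set ℂ}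
    (hOH : O ⊆ upperHalfPlaneSet) (hOb : IsBounded O) :
    closure (φ '' O) ⊆ φ.boundaryExtension '' closure O := by
  have hcl : closure O ⊆ closure upperHalfPlaneSet := closure_mono hOH
  have hcpt : IsCompact (φ.boundaryExtension '' closure O) :=
    hOb.isCompact_closure.image_of_continuousOn
      ((JordanDomain.continuousOn_boundaryExtension_of_disc hC D.toJordanDomain φ).mono hcl)
  refine closure_minimal ?_ hcpt.isClosed
  rintro _ ⟨x, hx, rfl⟩
  exact ⟨x, subset_closure hx, φ.boundaryExtension_eq (hOH hx)⟩

end Boundary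

/-! ### Components of `ℍ ∖ T` -/

section Component

variable {T : Set ℂ}

/-- A closure point in `ℍ ∖ T` of a component of `ℍ ∖ T` belongs to it (components of an open
set of the locally connected plane are open, hence relatively clopen). [folklore] -/
theorem mem_connectedComponentIn_of_mem_closure (hT : IsClosed T) {z q : ℂ}
    (hq : q ∈ closure (connectedComponentIn (upperHalfPlaneSet \ T) z))
    (hqH : q ∈ upperHalfPlaneSet) (hqT : q ∉ T) :
    q ∈ connectedComponentIn (upperHalfPlaneSet \ T) z := by
  have hopen : IsOpen (connectedComponentIn (upperHalfPlaneSet \ T) q) :=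
    (isOpen_upperHalfPlaneSet.sdiff hT).connectedComponentIn
  rw [mem_closure_iff_nhds] at hq
  obtain ⟨y, hyz, hyq⟩ := hq _ (hopen.mem_nhds (mem_connectedComponentIn ⟨hqH, hqT⟩))
  rw [connectedComponentIn_eq hyq, ← connectedComponentIn_eq hyz]
  exact mem_connectedComponentIn ⟨hqH, hqT⟩

/-- The component of a point off the unbounded component is bounded. [folklore] -/
theorem isBounded_connectedComponentIn_of_notMem {z : ℂ} (hz : z ∈ upperHalfPlaneSet)
    (hzT : z ∉ T) (hzU : z ∉ Loewner.unboundedComponent (upperHalfPlaneSet \ T)) :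
    IsBounded (connectedComponentIn (upperHalfPlaneSet \ T) z) := by
  by_contra hb
  exact hzU ⟨⟨hz, hzT⟩, hb⟩

/-- A bounded component of `ℍ ∖ T` lies in `hpFill T` together with its closure. [folklore] -/
theorem closure_connectedComponentIn_subset_hpFill {z : ℂ}
    (hb : IsBounded (connectedComponentIn (upperHalfPlaneSet \ T) z)) :
    closure (connectedComponentIn (upperHalfPlaneSet \ T) z) ⊆ hpFill T := by
  refine closure_mono fun x hx => ⟨(connectedComponentIn_subset _ _ hx).1, fun hxU => hxU.2 ?_⟩
  rwa [← connectedComponentIn_eq hx]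

end Component

/-! ### The pulled-back set of `K` and a Cantor intersection lemma -/

section Pullback

variable {D : DobrushinDomain} {φ : ConformalEquiv upperHalfPlaneSet D.carrier}

/-- The pulled-back set `{z ∈ cl ℍ | ψ z ∈ K}` of a closed `K` is closed.
[cite: PommerenkeBBCM1992, Thm. 2.6] -/
theorem isClosed_pullbackSet (hC : JordanDomain.exists_continuousOn_extension) {K : Set ℂ}
    (hK : IsClosed K) : IsClosed {z : ℂ | 0 ≤ z.im ∧ φ.boundaryExtension z ∈ K} := by
  have h := (JordanDomain.continuousOn_boundaryExtension_of_disc hC D.toJordanDomain φ)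
    |>.preimage_isClosed_of_isClosed isClosed_closure hK
  convert h using 1
  ext z
  simp only [mem_setOf_eq, mem_inter_iff, mem_preimage, mem_closure_upperHalfPlaneSet_iff]

/-- Avoidance of an image test set is avoidance of the test set by the pulled-back set
(`S ⊆ cl ℍ`). [folklore] -/
theorem disjoint_image_iff_disjoint_pullbackSet {K S : Set ℂ} (hS : S ⊆ closure upperHalfPlaneSet) :
    Disjoint K (φ.boundaryExtension '' S) ↔
      Disjoint {z : ℂ | 0 ≤ z.im ∧ φ.boundaryExtension z ∈ K} S := by
  rw [Set.disjoint_left, Set.disjoint_left]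
  constructor
  · rintro h z ⟨-, hzK⟩ hzS
    exact h hzK ⟨z, hzS, rfl⟩
  · rintro h p hpK ⟨z, hzS, rfl⟩
    exact h ⟨mem_closure_upperHalfPlaneSet_iff.1 (hS hzS), hpK⟩ hzS

/-- **Cantor intersection form of outer continuity**: a closed set disjoint from the
intersection of a decreasing sequence of closed sets, the first of which is compact, is disjoint
from one of them. [folklore] -/
theorem exists_disjoint_of_disjoint_iInter {K' : Set ℂ} (hK' : IsClosed K') {A : ℕ → Set ℂ}
    (hA : Antitone A) (hAc : ∀ k, IsClosed (A k)) (hA0 : IsCompact (A 0))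
    (h : Disjoint K' (⋂ k, A k)) : ∃ k, Disjoint K' (A k) := by
  set s : Set ℂ := K' ∩ A 0 with hs
  have hsc : IsCompact s := hA0.inter_left hK'
  have hempty : s ∩ ⋂ k, A k = ∅ :=
    Set.eq_empty_of_forall_notMem fun z hz => Set.disjoint_left.1 h hz.1.1 hz.2
  obtain ⟨k, hk⟩ := hsc.elim_directed_family_closed A hAc hempty
    (directed_of_isDirected_le fun i j hij => hA hij)
  refine ⟨k, Set.disjoint_left.2 fun z hzK hzA => ?_⟩
  have : z ∈ s ∩ A k := ⟨⟨hzK, hA (Nat.zero_le k) hzA⟩, hzA⟩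
  rw [hk] at this
  exact this

end Pullback

/-! ### The fill lemma -/

section Fill

variable {D : DobrushinDomain} {φ : ConformalEquiv upperHalfPlaneSet D.carrier} {K T : Set ℂ}

/-- **The frontier argument.** Let `O ⊆ ℍ` be a bounded open set all of whose closure points
in `ℍ ∖ O` lie in `T`, and `K` a set meeting `∂D` only inside `{a, b}` and avoiding `ψ(T)`.
A point `p ∈ K` of `cl φ(O) ∖ φ(O)` is `a`, and then `0 ∈ cl O`.
[cite: LawlerSchrammWerner2003Restriction, §2 p. 8 (Fillings), transposed] -/
theorem frontier_point (hC : JordanDomain.exists_continuousOn_extension)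
    (hφ : D.IsChordalUniformizing φ) (hKfr : K ∩ frontier D.carrier ⊆ {D.pt 0, D.pt 1})
    (hdisj : Disjoint K (φ.boundaryExtension '' T)) {O : Set ℂ} (hOH : O ⊆ upperHalfPlaneSet)
    (hOb : IsBounded O) (hOfr : ∀ q ∈ closure O, q ∉ O → 0 < q.im → q ∈ T) {p : ℂ}
    (hpK : p ∈ K) (hpcl : p ∈ closure (φ '' O)) (hpO : p ∉ φ '' O) :
    p = D.pt 0 ∧ (0 : ℂ) ∈ closure O := by
  obtain ⟨q, hq, rfl⟩ := closure_image_subset hC hOH hOb hpcl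
  have hqO : q ∉ O := fun h => hpO ⟨q, h, (φ.boundaryExtension_eq (hOH h)).symm⟩
  have hqim : 0 ≤ q.im := mem_closure_upperHalfPlaneSet_iff.1 (closure_mono hOH hq)
  rcases hqim.lt_or_eq with hpos | hzero
  · exact absurd (Set.disjoint_left.1 hdisj hpK ⟨q, hOfr q hq hqO hpos, rfl⟩) id
  · rcases hKfr ⟨hpK, boundaryExtension_mem_frontier_of_im_eq_zero hC hzero.symm⟩ with ha | hb
    · have hq0 : q = 0 := eq_zero_of_boundaryExtension_eq_pt_zero hC hφ hqim ha
      subst hq0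
      exact ⟨ha, hq⟩
    · exact absurd hb (MarkedDomain.boundaryExtension_ne_pt_one hC hφ hqim)

/-- **(i) `0 ∉ hpFill T`** when some connected `K ∋ a, b` in `cl D`, meeting `∂D` only at
`a, b`, avoids `ψ(T)` (`T ∌ 0` closed): module docstring.
[cite: LawlerSchrammWerner2003Restriction, §2 p. 8 (Fillings), transposed] -/
theorem zero_notMem_hpFill_of_disjoint (hC : JordanDomain.exists_continuousOn_extension)
    (hφ : D.IsChordalUniformizing φ) (hKD : K ⊆ closure D.carrier) (hKc : IsPreconnected K)
    (h0K : D.pt 0 ∈ K) (h1K : D.pt 1 ∈ K) (hKfr : K ∩ frontier D.carrier ⊆ {D.pt 0, D.pt 1})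
    (hT : IsClosed T) (h0T : (0 : ℂ) ∉ T) (hdisj : Disjoint K (φ.boundaryExtension '' T)) :
    (0 : ℂ) ∉ hpFill T := by
  intro h0
  set U : Set ℂ := Loewner.unboundedComponent (upperHalfPlaneSet \ T) with hU
  -- a ball about `0` missing `T`, and a point `w ∈ ℍ ∖ U` in it
  obtain ⟨r, hr, hball⟩ := Metric.isOpen_iff.1 hT.isOpen_compl 0 h0T
  have h0' : (0 : ℂ) ∈ closure (upperHalfPlaneSet \ U) := h0
  rw [mem_closure_iff_nhds] at h0'
  obtain ⟨w, hwB, hwH, hwU⟩ := h0' _ (ball_mem_nhds 0 hr)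
  have hwT : w ∉ T := fun h => hball hwB h
  -- its component `O` is bounded, open, in `ℍ`, and contains the half-disc `ℍ ∩ B(0, r)`
  set O : Set ℂ := connectedComponentIn (upperHalfPlaneSet \ T) w with hO
  have hOb : IsBounded O := isBounded_connectedComponentIn_of_notMem hwH hwT hwU
  have hOo : IsOpen O := (isOpen_upperHalfPlaneSet.sdiff hT).connectedComponentIn
  have hOH : O ⊆ upperHalfPlaneSet := fun x hx => (connectedComponentIn_subset _ _ hx).1
  have hVO : ball (0 : ℂ) r ∩ upperHalfPlaneSet ⊆ O :=
    ((convex_ball (0 : ℂ) r).inter (convex_halfSpace_im_gt 0)).isPreconnected.subset_connectedComponentIn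
      ⟨hwB, hwH⟩ fun x hx => ⟨hx.2, fun hxT => hball hx.1 hxT⟩
  have hOfr : ∀ q ∈ closure O, q ∉ O → 0 < q.im → q ∈ T := fun q hq hqO hqim => by
    by_contra hqT
    exact hqO (mem_connectedComponentIn_of_mem_closure hT hq hqim hqT)
  -- points of `D` near `a` pull back into `B(0, r)`, hence into `O`
  have hev : ∀ᶠ x in 𝓝[D.carrier] (D.pt 0), φ.symm x ∈ ball (0 : ℂ) r :=
    hφ.tendsto_symm_nhds_zero (ball_mem_nhds 0 hr)
  obtain ⟨s, hs, hsub⟩ := Metric.mem_nhdsWithin_iff.1 hev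
  have hab : D.pt 0 ≠ D.pt 1 := fun h => absurd (D.pt_injective h) (by decide)
  have hdab : 0 < dist (D.pt 1) (D.pt 0) := dist_pos.2 hab.symm
  set s' : ℝ := min (s / 2) (dist (D.pt 1) (D.pt 0) / 2) with hs'
  have hs'0 : 0 < s' := lt_min (half_pos hs) (half_pos hdab)
  have hs's : s' < s := (min_le_left _ _).trans_lt (half_lt_self hs)
  have hs'd : s' < dist (D.pt 1) (D.pt 0) := (min_le_right _ _).trans_lt (half_lt_self hdab)
  have hnear : ∀ x ∈ D.carrier, dist x (D.pt 0) < s → x ∈ φ '' O := fun x hxD hxs => by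
    have h1 : φ.symm x ∈ ball (0 : ℂ) r := hsub ⟨hxs, hxD⟩
    exact ⟨φ.symm x, hVO ⟨h1, φ.symm_mapsTo hxD⟩, φ.apply_symm_apply hxD⟩
  -- the open set `G = φ(O) ∪ B(a, s')` meets `K` at `a` and misses `b ∈ K`
  set G : Set ℂ := φ '' O ∪ ball (D.pt 0) s' with hG
  have hGo : IsOpen G := (isOpen_image hOo hOH).union isOpen_ball
  have hmeet : (K ∩ G).Nonempty := ⟨D.pt 0, h0K, Or.inr (mem_ball_self hs'0)⟩
  have hbG : D.pt 1 ∉ G := by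
    rintro (⟨x, hx, hxb⟩ | hb)
    · exact D.pt_notMem_carrier 1 (hxb ▸ φ.mapsTo (hOH hx))
    · exact (not_lt.2 hs'd.le) (mem_ball.1 hb)
  have hnot : ¬ (closure G ∩ K ⊆ G) := fun h =>
    hbG (hKc.subset_of_closure_inter_subset hGo hmeet h h1K)
  obtain ⟨p, ⟨hpcl, hpK⟩, hpG⟩ := Set.not_subset.1 hnot
  rw [hG, closure_union] at hpcl
  rcases hpcl with hp1 | hp2
  · obtain ⟨hpa, -⟩ := frontier_point hC hφ hKfr hdisj hOH hOb hOfr hpK hp1 fun h => hpG (Or.inl h)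
    exact hpG (Or.inr (by rw [hpa]; exact mem_ball_self hs'0))
  · have hpd : dist p (D.pt 0) ≤ s' := closure_ball_subset_closedBall hp2
    have hpd' : s' ≤ dist p (D.pt 0) := not_lt.1 fun h => hpG (Or.inr h)
    by_cases hpD : p ∈ D.carrier
    · exact hpG (Or.inl (hnear p hpD (hpd.trans_lt hs's)))
    · have hpfr : p ∈ frontier D.carrier := ⟨hKD hpK, by rwa [D.isOpen.interior_eq]⟩
      rcases hKfr ⟨hpK, hpfr⟩ with hpa | hpb
      · rw [hpa, dist_self] at hpd'
        exact absurd hpd' (not_le.2 hs'0)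
      · rw [mem_singleton_iff] at hpb
        rw [hpb] at hpd
        exact absurd (hpd.trans_lt hs'd) (lt_irrefl _)

/-- **(ii) Interior points of `K` pull back into the unbounded component of `ℍ ∖ T`.**
[cite: LawlerSchrammWerner2003Restriction, §2 p. 8 (Fillings), transposed] -/
theorem mem_unboundedComponent_of_apply_mem (hC : JordanDomain.exists_continuousOn_extension)
    (hφ : D.IsChordalUniformizing φ) (hKD : K ⊆ closure D.carrier) (hKc : IsPreconnected K)
    (h0K : D.pt 0 ∈ K) (h1K : D.pt 1 ∈ K) (hKfr : K ∩ frontier D.carrier ⊆ {D.pt 0, D.pt 1})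
    (hT : IsClosed T) (h0T : (0 : ℂ) ∉ T) (hdisj : Disjoint K (φ.boundaryExtension '' T))
    {z : ℂ} (hz : z ∈ upperHalfPlaneSet) (hzK : φ z ∈ K) :
    z ∈ Loewner.unboundedComponent (upperHalfPlaneSet \ T) := by
  by_contra hzU
  have hzT : z ∉ T := fun h =>
    Set.disjoint_left.1 hdisj hzK ⟨z, h, φ.boundaryExtension_eq hz⟩
  set O : Set ℂ := connectedComponentIn (upperHalfPlaneSet \ T) z with hO
  have hOb : IsBounded O := isBounded_connectedComponentIn_of_notMem hz hzT hzU
  have hOo : IsOpen O := (isOpen_upperHalfPlaneSet.sdiff hT).connectedComponentIn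
  have hOH : O ⊆ upperHalfPlaneSet := fun x hx => (connectedComponentIn_subset _ _ hx).1
  have hOfr : ∀ q ∈ closure O, q ∉ O → 0 < q.im → q ∈ T := fun q hq hqO hqim => by
    by_contra hqT
    exact hqO (mem_connectedComponentIn_of_mem_closure hT hq hqim hqT)
  have hGo : IsOpen (φ '' O) := isOpen_image hOo hOH
  have hmeet : (K ∩ φ '' O).Nonempty := ⟨φ z, hzK, z, mem_connectedComponentIn ⟨hz, hzT⟩, rfl⟩
  have hbG : D.pt 1 ∉ φ '' O := by
    rintro ⟨x, hx, hxb⟩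
    exact D.pt_notMem_carrier 1 (hxb ▸ φ.mapsTo (hOH hx))
  have hnot : ¬ (closure (φ '' O) ∩ K ⊆ φ '' O) := fun h =>
    hbG (hKc.subset_of_closure_inter_subset hGo hmeet h h1K)
  obtain ⟨p, ⟨hpcl, hpK⟩, hpG⟩ := Set.not_subset.1 hnot
  obtain ⟨-, h0cl⟩ := frontier_point hC hφ hKfr hdisj hOH hOb hOfr hpK hpcl hpG
  exact zero_notMem_hpFill_of_disjoint hC hφ hKD hKc h0K h1K hKfr hT h0T hdisj
    (closure_connectedComponentIn_subset_hpFill hOb h0cl)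

/-- **(iii) The fill lemma: `K` avoids `ψ(hpFill T)`.**
[cite: LawlerSchrammWerner2003Restriction, §2 p. 8 (Fillings) and Lemma 3.2, transposed] -/
theorem disjoint_image_hpFill (hC : JordanDomain.exists_continuousOn_extension)
    (hφ : D.IsChordalUniformizing φ) (hKD : K ⊆ closure D.carrier) (hKc : IsPreconnected K)
    (h0K : D.pt 0 ∈ K) (h1K : D.pt 1 ∈ K) (hKfr : K ∩ frontier D.carrier ⊆ {D.pt 0, D.pt 1})
    (hT : IsClosed T) (hTb : IsBounded T) (h0T : (0 : ℂ) ∉ T)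
    (hdisj : Disjoint K (φ.boundaryExtension '' T)) :
    Disjoint K (φ.boundaryExtension '' hpFill T) := by
  refine Set.disjoint_left.2 ?_
  rintro _ hpK ⟨q, hq, rfl⟩
  have hqim : 0 ≤ q.im := mem_closure_upperHalfPlaneSet_iff.1 (hpFill_subset_closure T hq)
  rcases hqim.lt_or_eq with hpos | hzero
  · have hqH : q ∈ upperHalfPlaneSet := hpos
    have h1 : q ∈ hpFill T ∩ upperHalfPlaneSet := ⟨hq, hqH⟩
    rw [hpFill_inter hT hTb] at h1
    rw [φ.boundaryExtension_eq hqH] at hpK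
    exact h1.2 (mem_unboundedComponent_of_apply_mem hC hφ hKD hKc h0K h1K hKfr hT h0T hdisj hqH hpK)
  · have hq0 : q = 0 := eq_zero_of_im_eq_zero_of_mem hC hφ hKfr hzero.symm hpK
    subst hq0
    exact zero_notMem_hpFill_of_disjoint hC hφ hKD hKc h0K h1K hKfr hT h0T hdisj hq

/-! ### Registered form (part 2a of `stub_rangeIdentification`) -/

/-- **Registered helper `rangeIdentification_fill`** (crux item stmt-CriticalPhenomena-0808, line
`root-locality-replaces-loewner`, stub `stub_rangeIdentification`, part 2a): THE FILL LEMMA for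
compact connected sets from `a` to `b` meeting `∂D` only at `a, b` — avoiding the image `ψ(T)`
of a closed bounded half-plane set `T ∌ 0` forces `0 ∉ hpFill T` and avoiding `ψ(hpFill T)`
([LSW] §2 "Fillings" and Lemma 3.2, for random compact sets instead of simple paths).
[cite: LawlerSchrammWerner2003Restriction, §2 p. 8 and Lemma 3.2, transposed] -/
theorem rangeIdentification_fill : ∀ (D : Literature.Probability.RandomPlanarGeometry.DobrushinDomain) (φ : Literature.Probability.RandomPlanarGeometry.ConformalEquiv UpperHalfPlane.upperHalfPlaneSet D.carrier) (K T : Set ℂ), D.IsChordalUniformizing φ → K ⊆ closure D.carrier → IsPreconnected K → D.pt 0 ∈ K → D.pt 1 ∈ K → K ∩ frontier D.carrier ⊆ {D.pt 0, D.pt 1} → IsClosed T → Bornology.IsBounded T → (0 : ℂ) ∉ T → Disjoint K (φ.boundaryExtension '' T) → (0 : ℂ) ∉ Literature.Probability.RandomPlanarGeometry.hpFill T ∧ Disjoint K (φ.boundaryExtension '' Literature.Probability.RandomPlanarGeometry.hpFill T) :=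
  fun _ _ _ _ hφ hKD hKc h0K h1K hKfr hT hTb h0T hdisj =>
    ⟨zero_notMem_hpFill_of_disjoint JordanDomain.exists_continuousOn_extension_holds hφ hKD hKc
        h0K h1K hKfr hT h0T hdisj,
      disjoint_image_hpFill JordanDomain.exists_continuousOn_extension_holds hφ hKD hKc h0K h1K
        hKfr hT hTb h0T hdisj⟩

end Fill

end Summit.CriticalPhenomena.SAWScalingLimit.Theorems.HexConjecture.RootLocality.Range

end
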